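import Summits.PneNP.PneNP.Theorems.KarlinRubinMonotoneBlindDnfPlanted
import Summits.PneNP.PneNP.Theorems.ResolutionUncertainty.Negative.ShadowSeparators
import Summits.PneNP.PneNP.Theorems.MonotoneContinuation.Negative.StarParity
import Literature.Probability.Moments.HoeffdingCounting

/-!
# `MonotoneBlind` (stmt-PneNP-18027, route PneNP/KarlinRubin, crux #3) — negative-side lemmas III(a):
# Kučera's max-degree test as a monotone circuit, with its error counts

Crux-disprover output (cdisprove cycle 1), first half of the construction closing the near-miss of
`Cruxes/MonotoneBlind/Disproof.lean` §B (the crux's hypothesis `0 < δ` is sharp): the MONOTONE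
statistic that detects planted cliques just above `√n`, built inside the tree's straight-line
circuit model, and its two error bounds in counting form.

* §1 the `n - 1` edge slots `star v` at a vertex (REUSED from
  `Theorems/MonotoneContinuation/Negative/StarParity.lean`, with its `card_star`);
  the number of absent slots `#{e ∈ star v : x e = 0}` (= `n - 1 - deg v`).
* §2 `count_fewZeros_le`, `count_manyZeros_le` — Hoeffding (counting form,
  `Literature.Probability.Moments.hoeffding_count_pi`) for the number of zeros of `x` on a set of
  `d` slots: both tails `≤ exp(-2t²/d) · 2^{#E}`.
* §3 `exists_circuit_degTest` — the MAX-DEGREE TEST `[∃ v : #zeros at v ≤ j₀]` (i.e.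
  `[∃ v : deg v ≥ n - 1 - j₀]`) is computed by a `{∧₂, ∨₂, 0, 1}`-circuit with
  `≤ n (1 + (n-1)(2 j₀ + 4)) + (n + 1)` gates: per vertex the monotone counting network
  `exists_cktSize_fewZeroBlocks` of `Theorems/ResolutionUncertainty/Negative/ShadowSeparators.lean`
  on singleton blocks, then an OR-chain.
* §4 `degTest_typeI_count`, `degTest_typeII_count` — type I `≤ n · exp(-2t²/(n-1)) · 2^{#E}`
  for `t ≤ (n-1)/2 - j₀` (union bound over vertices); type II, for a planted set `A ∋ v₀` with
  `#A < n`, `≤ exp(-2t²/(n-#A)) · 2^{#E}` for `t ≤ j₀ + 1 - (n-#A)/2` (the planted vertex keeps its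
  `#A - 1` clique neighbours; Hoeffding on its `≤ n - #A` free slots).

The probability forms, the choice `j₀ = ⌊(2n-k)/4⌋` and the asymptotics are in `DegreeTest.lean`.
[Kucera1995 §1 ("vertices of the clique have the largest degrees" for `k ≥ c√(n log n)`)]
Refuter seat refuter-cdisprove-stmt-PneNP-18027-0 (cdisprove, gen 1), 2026-08-17.
-/

set_option linter.dupNamespace false

namespace Summit.PneNP.PneNP.Theorems.MonotoneBlind.Negative

open Literature.Computability.Complexity Literature.Probability.RandomGraphs.PlantedClique Filter Finset
open Literature.Probability.Moments
open Summit.PneNP.PneNP.Theorems.ResolutionUncertainty.Negative (exists_cktSize_fewZeroBlocks cktSize_listOr)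
open Summit.PneNP.PneNP.Theorems.MonotoneContinuation.Negative (star card_star)
open scoped ENNReal

variable {n : ℕ}

/-! ## §1 Edge slots at a vertex -/

omit n in
/-- Membership in `star v`. [folklore] -/
theorem mem_star {n : ℕ} {v : Fin n} {e : (⊤ : SimpleGraph (Fin n)).edgeSet} :
    e ∈ star v ↔ v ∈ (e : Sym2 (Fin n)) := by
  rw [Summit.PneNP.PneNP.Theorems.MonotoneContinuation.Negative.star, mem_filter]
  simp

/-- The slot `{v, u}` (`u ≠ v`) lies in `star v`. [folklore] -/
theorem mk_mem_star (v u : Fin n) (h : u ≠ v) :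
    (⟨s(v, u), by simpa using h.symm⟩ : (⊤ : SimpleGraph (Fin n)).edgeSet) ∈ star v :=
  mem_star.2 (Sym2.mem_mk_left v u)


/-! ## §2 Hoeffding for the number of zeros on a set of slots -/

/-- The signed count: `Σ_{e ∈ D} (x_e ? 1/2 : -1/2) = #D/2 - #zeros`. [folklore] -/
theorem sum_sign_eq (D : Finset ((⊤ : SimpleGraph (Fin n)).edgeSet)) (x : EdgeVec n) :
    ∑ e ∈ D, (if x e then (1 / 2 : ℝ) else -(1 / 2)) =
      (#D : ℝ) / 2 - #(D.filter fun e => x e = false) := by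
  have h : ∀ e ∈ D, (if x e then (1 / 2 : ℝ) else -(1 / 2)) =
      1 / 2 - (if x e = false then (1 : ℝ) else 0) := by
    intro e _
    cases x e <;> norm_num
  rw [sum_congr rfl h, sum_sub_distrib, sum_const, nsmul_eq_mul, sum_boole]
  ring

/-- **Few zeros (high degree) is rare.** For a nonempty set `D` of slots and `t ≥ 0`,
`#{x : t ≤ #D/2 - #zeros_D(x)} ≤ exp(-2t²/#D) · 2^{#E}`. [folklore] -/
theorem count_fewZeros_le (D : Finset ((⊤ : SimpleGraph (Fin n)).edgeSet)) (hD : 0 < #D)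
    {t : ℝ} (ht : 0 ≤ t) :
    (#(univ.filter fun x : EdgeVec n =>
        t ≤ (#D : ℝ) / 2 - #(D.filter fun e => x e = false)) : ℝ) ≤
      Real.exp (-(2 * t ^ 2 / #D)) * 2 ^ Fintype.card (⊤ : SimpleGraph (Fin n)).edgeSet := by
  classical
  set f : ∀ _ : (⊤ : SimpleGraph (Fin n)).edgeSet, Bool → ℝ :=
    fun e b => if e ∈ D then (if b then 1 / 2 else -(1 / 2)) else 0 with hf
  set c : (⊤ : SimpleGraph (Fin n)).edgeSet → ℝ := fun e => if e ∈ D then 1 / 2 else 0 with hc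
  have hf0 : ∀ e, ∑ b, f e b = 0 := fun e => by
    by_cases he : e ∈ D <;> simp [hf, he]
  have hfc : ∀ e b, |f e b| ≤ c e := fun e b => by
    by_cases he : e ∈ D <;> cases b <;> simp [hf, hc, he]
  have hcsum : ∑ e, c e ^ 2 = #D / 4 := by
    have : ∀ e, c e ^ 2 = if e ∈ D then (1 / 4 : ℝ) else 0 := fun e => by
      by_cases he : e ∈ D <;> norm_num [hc, he]
    simp_rw [this]
    rw [sum_ite_mem, univ_inter, sum_const, nsmul_eq_mul]
    ring
  have hstat : ∀ x : EdgeVec n, ∑ e, f e (x e) = (#D : ℝ) / 2 - #(D.filter fun e => x e = false) := by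
    intro x
    have : ∑ e, f e (x e) = ∑ e ∈ D, (if x e then (1 / 2 : ℝ) else -(1 / 2)) := by
      simp only [hf]
      rw [sum_ite_mem, univ_inter]
    rw [this, sum_sign_eq]
  have hSpos : 0 < ∑ e, c e ^ 2 := by
    rw [hcsum]
    have : (0 : ℝ) < #D := by exact_mod_cast hD
    positivity
  have hH := hoeffding_count_pi (κ := fun _ => Bool) f c hf0 hfc ht hSpos
  have hprod : ∏ _e : (⊤ : SimpleGraph (Fin n)).edgeSet, (Fintype.card Bool : ℝ) =
      2 ^ Fintype.card (⊤ : SimpleGraph (Fin n)).edgeSet := by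
    rw [prod_const, card_univ, Fintype.card_bool]; norm_num
  rw [hprod, hcsum] at hH
  have hexp : Real.exp (-(t ^ 2 / (2 * (#D / 4 : ℝ)))) = Real.exp (-(2 * t ^ 2 / #D)) := by
    congr 1
    have : (0 : ℝ) < #D := by exact_mod_cast hD
    field_simp
    ring
  rw [hexp] at hH
  refine le_trans (le_of_eq ?_) hH
  congr 2
  ext x
  simp only [mem_filter, mem_univ, true_and, hstat x]

/-- **Many zeros (low degree) is rare.** For a nonempty set `D` of slots and `t ≥ 0`,
`#{x : t ≤ #zeros_D(x) - #D/2} ≤ exp(-2t²/#D) · 2^{#E}`. [folklore] -/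
theorem count_manyZeros_le (D : Finset ((⊤ : SimpleGraph (Fin n)).edgeSet)) (hD : 0 < #D)
    {t : ℝ} (ht : 0 ≤ t) :
    (#(univ.filter fun x : EdgeVec n =>
        t ≤ (#(D.filter fun e => x e = false) : ℝ) - (#D : ℝ) / 2) : ℝ) ≤
      Real.exp (-(2 * t ^ 2 / #D)) * 2 ^ Fintype.card (⊤ : SimpleGraph (Fin n)).edgeSet := by
  classical
  set f : ∀ _ : (⊤ : SimpleGraph (Fin n)).edgeSet, Bool → ℝ :=
    fun e b => if e ∈ D then (if b then -(1 / 2) else 1 / 2) else 0 with hf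
  set c : (⊤ : SimpleGraph (Fin n)).edgeSet → ℝ := fun e => if e ∈ D then 1 / 2 else 0 with hc
  have hf0 : ∀ e, ∑ b, f e b = 0 := fun e => by
    by_cases he : e ∈ D <;> simp [hf, he]
  have hfc : ∀ e b, |f e b| ≤ c e := fun e b => by
    by_cases he : e ∈ D <;> cases b <;> simp [hf, hc, he]
  have hcsum : ∑ e, c e ^ 2 = #D / 4 := by
    have : ∀ e, c e ^ 2 = if e ∈ D then (1 / 4 : ℝ) else 0 := fun e => by
      by_cases he : e ∈ D <;> norm_num [hc, he]
    simp_rw [this]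
    rw [sum_ite_mem, univ_inter, sum_const, nsmul_eq_mul]
    ring
  have hstat : ∀ x : EdgeVec n, ∑ e, f e (x e) = (#(D.filter fun e => x e = false) : ℝ) - (#D : ℝ) / 2 := by
    intro x
    have h1 : ∑ e, f e (x e) = ∑ e ∈ D, (if x e then -(1 / 2 : ℝ) else 1 / 2) := by
      simp only [hf]
      rw [sum_ite_mem, univ_inter]
    have h2 : ∑ e ∈ D, (if x e then -(1 / 2 : ℝ) else 1 / 2) =
        -∑ e ∈ D, (if x e then (1 / 2 : ℝ) else -(1 / 2)) := by
      rw [← sum_neg_distrib]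
      refine sum_congr rfl fun e _ => ?_
      cases x e <;> norm_num
    rw [h1, h2, sum_sign_eq]
    ring
  have hSpos : 0 < ∑ e, c e ^ 2 := by
    rw [hcsum]
    have : (0 : ℝ) < #D := by exact_mod_cast hD
    positivity
  have hH := hoeffding_count_pi (κ := fun _ => Bool) f c hf0 hfc ht hSpos
  have hprod : ∏ _e : (⊤ : SimpleGraph (Fin n)).edgeSet, (Fintype.card Bool : ℝ) =
      2 ^ Fintype.card (⊤ : SimpleGraph (Fin n)).edgeSet := by
    rw [prod_const, card_univ, Fintype.card_bool]; norm_num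
  rw [hprod, hcsum] at hH
  have hexp : Real.exp (-(t ^ 2 / (2 * (#D / 4 : ℝ)))) = Real.exp (-(2 * t ^ 2 / #D)) := by
    congr 1
    have : (0 : ℝ) < #D := by exact_mod_cast hD
    field_simp
    ring
  rw [hexp] at hH
  refine le_trans (le_of_eq ?_) hH
  congr 2
  ext x
  simp only [mem_filter, mem_univ, true_and, hstat x]

/-! ## §3 The max-degree test as a monotone circuit -/

/-- **The max-degree test is a small monotone circuit.** The MAX-DEGREE TEST with zero-budget `j₀`
accepts iff some vertex misses at most `j₀` of its `n - 1` possible edges (iff `maxdeg ≥ n - 1 - j₀`),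
`x ↦ [∃ v : #{e ∈ star v : x e = 0} ≤ j₀]`; it has a `{∧₂, ∨₂, 0, 1}`-circuit with
`≤ n (1 + (n-1)(2j₀+4)) + (n+1)` gates — per vertex the counting network "at most `j₀` of the slots at
`v` are off" (`exists_cktSize_fewZeroBlocks` on singleton blocks), then an OR-chain over the vertices.
[Kucera1995 §1] [folklore] -/
theorem exists_circuit_degTest (n j₀ : ℕ) :
    ∃ C : Circuit ((⊤ : SimpleGraph (Fin n)).edgeSet), C.IsOver monotoneBasis01 ∧
      C.size ≤ n * (1 + (n - 1) * (1 + 2 * j₀ + 3)) + (n + 1) ∧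
      C.Computes (fun x => decide (∃ v : Fin n, #((star v).filter fun e => x e = false) ≤ j₀)) := by
  classical
  have hv : ∀ v : Fin n, ∃ f : EdgeVec n → Unit → Bool,
      CktSize monotoneBasis01 f (1 + (n - 1) * (1 + 2 * j₀ + 3)) ∧
        ∀ x, f x () = decide (#((star v).filter fun e => x e = false) ≤ j₀) := by
    intro v
    obtain ⟨f, hf, hacc, hrej⟩ := exists_cktSize_fewZeroBlocks
      (ι := (⊤ : SimpleGraph (Fin n)).edgeSet) (star v)
      (fun e => ({e} : Finset (⊤ : SimpleGraph (Fin n)).edgeSet)) j₀ 1 (fun e _ => by simp)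
    refine ⟨f, by rwa [card_star] at hf, fun x => ?_⟩
    by_cases h : #((star v).filter fun e => x e = false) ≤ j₀
    · rw [decide_eq_true h]
      refine hacc x ((star v).filter fun e => x e = false) (fun e he hz => ?_) h
      exact mem_filter.2 ⟨he, hz e (mem_singleton_self e)⟩
    · rw [decide_eq_false h]
      refine hrej x ((star v).filter fun e => x e = false) (filter_subset _ _) (not_le.1 h) ?_
      intro e he e' he'
      rw [mem_singleton] at he'
      subst he'
      exact (mem_filter.1 he).2
  choose f hf hfx using hv
  have hpi : CktSize monotoneBasis01 (fun (x : EdgeVec n) (v : Fin n) => f v x ())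
      (∑ _v : Fin n, (1 + (n - 1) * (1 + 2 * j₀ + 3))) := CktSize.pi fun v => hf v
  have hcomp := hpi.comp (cktSize_listOr (ι := Fin n) (List.finRange n))
  obtain ⟨C, hCB, hCs, hCe⟩ := hcomp.toCircuit
  refine ⟨C, hCB, hCs.trans (le_of_eq ?_), fun x => ?_⟩
  · simp [sum_const, card_univ, Fintype.card_fin, List.length_finRange]
  · rw [hCe, Bool.eq_iff_iff]
    simp [List.any_eq_true, hfx]

/-! ## §4 Error bounds by counting -/

/-- A count bound `#S ≤ b · 2^{#E}` is the probability bound `Pr_{G(n,1/2)}[S] ≤ b`. [folklore] -/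
theorem erdosRenyiHalf_le_ofReal (S : Set (EdgeVec n)) [DecidablePred (· ∈ S)] {b : ℝ} (hb : 0 ≤ b)
    (h : (#(univ.filter fun x : EdgeVec n => x ∈ S) : ℝ) ≤
      b * 2 ^ Fintype.card (⊤ : SimpleGraph (Fin n)).edgeSet) :
    (erdosRenyiHalf n).toOuterMeasure S ≤ ENNReal.ofReal b := by
  rw [Summit.PneNP.PneNP.Theorems.erdosRenyiHalf_toOuterMeasure_eq_card_div]
  have huniv : (Fintype.card (EdgeVec n) : ℝ≥0∞) =
      2 ^ Fintype.card (⊤ : SimpleGraph (Fin n)).edgeSet := by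
    rw [Fintype.card_fun, Fintype.card_bool]; push_cast; rfl
  rw [huniv, ENNReal.div_le_iff (pow_ne_zero _ two_ne_zero) (ENNReal.pow_ne_top ENNReal.ofNat_ne_top)]
  have h2 : (2 : ℝ≥0∞) ^ Fintype.card (⊤ : SimpleGraph (Fin n)).edgeSet =
      ENNReal.ofReal ((2 : ℝ) ^ Fintype.card (⊤ : SimpleGraph (Fin n)).edgeSet) := by
    rw [ENNReal.ofReal_pow zero_le_two, ENNReal.ofReal_ofNat]
  rw [h2, ← ENNReal.ofReal_mul hb, ← ENNReal.ofReal_natCast]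
  exact ENNReal.ofReal_le_ofReal h

/-- **Type I.** For `2 ≤ n` and `0 ≤ t ≤ (n-1)/2 - j₀`: the graphs of `G(n,1/2)` on which the max-degree
test fires number at most `n · exp(-2t²/(n-1)) · 2^{#E}` (Hoeffding at each vertex, union bound).
[Kucera1995 §1] [folklore] -/
theorem degTest_typeI_count (n j₀ : ℕ) (hn : 2 ≤ n) {t : ℝ} (ht : 0 ≤ t)
    (hj : t ≤ ((n - 1 : ℕ) : ℝ) / 2 - j₀) :
    (#(univ.filter fun x : EdgeVec n => decide (∃ v : Fin n, #((star v).filter fun e => x e = false) ≤ j₀) = true) : ℝ) ≤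
      n * (Real.exp (-(2 * t ^ 2 / (n - 1 : ℕ))) * 2 ^ Fintype.card (⊤ : SimpleGraph (Fin n)).edgeSet) := by
  classical
  have hsub : (univ.filter fun x : EdgeVec n => decide (∃ v : Fin n, #((star v).filter fun e => x e = false) ≤ j₀) = true) ⊆
      (univ : Finset (Fin n)).biUnion fun v => univ.filter fun x : EdgeVec n =>
        t ≤ (#(star v) : ℝ) / 2 - #((star v).filter fun e => x e = false) := by
    intro x hx
    simp only [mem_filter, mem_univ, true_and, decide_eq_true_eq] at hx
    obtain ⟨v, hv⟩ := hx
    refine mem_biUnion.2 ⟨v, mem_univ _, mem_filter.2 ⟨mem_univ _, ?_⟩⟩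
    rw [card_star]
    have : (#((star v).filter fun e => x e = false) : ℝ) ≤ j₀ := by exact_mod_cast hv
    linarith
  have hD : ∀ v : Fin n, 0 < #(star v) := fun v => by rw [card_star]; omega
  calc (#(univ.filter fun x : EdgeVec n => decide (∃ v : Fin n, #((star v).filter fun e => x e = false) ≤ j₀) = true) : ℝ)
      ≤ #((univ : Finset (Fin n)).biUnion fun v => univ.filter fun x : EdgeVec n =>
          t ≤ (#(star v) : ℝ) / 2 - #((star v).filter fun e => x e = false)) := by
        exact_mod_cast card_le_card hsub
    _ ≤ ∑ v : Fin n, (#(univ.filter fun x : EdgeVec n =>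
          t ≤ (#(star v) : ℝ) / 2 - #((star v).filter fun e => x e = false)) : ℝ) := by
        exact_mod_cast card_biUnion_le
    _ ≤ ∑ _v : Fin n, Real.exp (-(2 * t ^ 2 / (n - 1 : ℕ))) *
          2 ^ Fintype.card (⊤ : SimpleGraph (Fin n)).edgeSet := by
        refine sum_le_sum fun v _ => ?_
        have := count_fewZeros_le (star v) (hD v) ht
        rw [card_star] at this ⊢
        exact this
    _ = n * (Real.exp (-(2 * t ^ 2 / (n - 1 : ℕ))) * 2 ^ Fintype.card (⊤ : SimpleGraph (Fin n)).edgeSet) := by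
        rw [sum_const, card_univ, Fintype.card_fin, nsmul_eq_mul]

/-- Planting keeps an edge off iff it was off and is not inside the planted set. [folklore] -/
theorem plant_eq_false_iff {A : Finset (Fin n)} {x : EdgeVec n} {e : (⊤ : SimpleGraph (Fin n)).edgeSet} :
    plant A x e = false ↔ x e = false ∧ ¬ ∀ w ∈ (e : Sym2 (Fin n)), w ∈ A := by
  classical
  simp [plant]

/-- **Type II, one planted set.** If `v₀ ∈ A`, `#A < n` and `0 ≤ t ≤ j₀ + 1 - (n - #A)/2`, the noise
vectors `x` for which the max-degree test REJECTS `plant A x` number at most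
`exp(-2t²/(n - #A)) · 2^{#E}`: rejection forces `> j₀` absent edges at `v₀`, all among its `≤ n - #A`
free slots (Hoeffding, lower tail). [Kucera1995 §1] [folklore] -/
theorem degTest_typeII_count (n j₀ : ℕ) {A : Finset (Fin n)} {v₀ : Fin n} (hv₀ : v₀ ∈ A)
    (hAn : #A < n) {t : ℝ} (ht : 0 ≤ t) (hj : t ≤ (j₀ : ℝ) + 1 - ((n - #A : ℕ) : ℝ) / 2) :
    (#(univ.filter fun x : EdgeVec n => decide (∃ v : Fin n, #((star v).filter fun e => plant A x e = false) ≤ j₀) = false) : ℝ) ≤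
      Real.exp (-(2 * t ^ 2 / (n - #A : ℕ))) * 2 ^ Fintype.card (⊤ : SimpleGraph (Fin n)).edgeSet := by
  classical
  -- the free slots at `v₀`
  set D : Finset (⊤ : SimpleGraph (Fin n)).edgeSet :=
    (star v₀).filter fun e => ¬ ∀ w ∈ (e : Sym2 (Fin n)), w ∈ A with hDdef
  -- `#D ≤ n - #A`
  have hin : #A - 1 ≤ #((star v₀).filter
      fun e : (⊤ : SimpleGraph (Fin n)).edgeSet => ∀ w ∈ (e : Sym2 (Fin n)), w ∈ A) := by
    have h1 : #(A.erase v₀) = #A - 1 := card_erase_of_mem hv₀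
    rw [← h1, ← card_map (Function.Embedding.subtype (· ∈ (⊤ : SimpleGraph (Fin n)).edgeSet))]
    refine card_le_card_of_injOn (fun u : Fin n => (s(v₀, u) : Sym2 (Fin n))) (fun u hu => ?_)
      (fun u₁ _ u₂ _ heq => Sym2.congr_right.1 heq)
    have hne : u ≠ v₀ := ne_of_mem_erase (mem_coe.1 hu)
    refine mem_coe.2 (mem_map.2 ⟨⟨s(v₀, u), by simpa using hne.symm⟩,
      mem_filter.2 ⟨mk_mem_star v₀ u hne, ?_⟩, rfl⟩)
    intro w hw
    simp only [Sym2.mem_iff] at hw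
    rcases hw with rfl | rfl
    · exact hv₀
    · exact mem_of_mem_erase (mem_coe.1 hu)
  have hDcard : #D ≤ n - #A := by
    have hsplit := card_filter_add_card_filter_not (α := (⊤ : SimpleGraph (Fin n)).edgeSet)
      (s := star v₀) (fun e : (⊤ : SimpleGraph (Fin n)).edgeSet => ∀ w ∈ (e : Sym2 (Fin n)), w ∈ A)
    rw [card_star] at hsplit
    have hA1 : 1 ≤ #A := card_pos.2 ⟨v₀, hv₀⟩
    simp only [hDdef]
    omega
  -- `D` is nonempty: a vertex outside `A`
  have hDpos : 0 < #D := by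
    obtain ⟨u, -, hu⟩ : ∃ u ∈ (univ : Finset (Fin n)), u ∉ A :=
      exists_mem_notMem_of_card_lt_card (by rw [card_univ, Fintype.card_fin]; exact hAn)
    have hne : u ≠ v₀ := fun h => hu (h ▸ hv₀)
    refine card_pos.2 ⟨⟨s(v₀, u), by simpa using hne.symm⟩,
      mem_filter.2 ⟨mk_mem_star v₀ u hne, fun h => hu ?_⟩⟩
    exact h u (by simp)
  -- rejection ⇒ many zeros on `D`
  have hsub : (univ.filter fun x : EdgeVec n => decide (∃ v : Fin n, #((star v).filter fun e => plant A x e = false) ≤ j₀) = false) ⊆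
      univ.filter fun x : EdgeVec n => t ≤ (#(D.filter fun e => x e = false) : ℝ) - (#D : ℝ) / 2 := by
    intro x hx
    simp only [mem_filter, mem_univ, true_and, decide_eq_false_iff_not, not_exists, not_le] at hx
    have hz : j₀ < #((star v₀).filter fun e => plant A x e = false) := hx v₀
    have hzD : #((star v₀).filter fun e => plant A x e = false) = #(D.filter fun e => x e = false) := by
      simp only [hDdef, filter_filter]
      congr 1
      refine filter_congr fun e _ => ?_
      rw [plant_eq_false_iff, and_comm]
    rw [hzD] at hz
    refine mem_filter.2 ⟨mem_univ _, ?_⟩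
    have h1 : (j₀ : ℝ) + 1 ≤ #(D.filter fun e => x e = false) := by exact_mod_cast hz
    have h2 : (#D : ℝ) ≤ ((n - #A : ℕ) : ℝ) := by exact_mod_cast hDcard
    linarith
  calc (#(univ.filter fun x : EdgeVec n => decide (∃ v : Fin n, #((star v).filter fun e => plant A x e = false) ≤ j₀) = false) : ℝ)
      ≤ #(univ.filter fun x : EdgeVec n => t ≤ (#(D.filter fun e => x e = false) : ℝ) - (#D : ℝ) / 2) := by
        exact_mod_cast card_le_card hsub
    _ ≤ Real.exp (-(2 * t ^ 2 / #D)) * 2 ^ Fintype.card (⊤ : SimpleGraph (Fin n)).edgeSet :=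
        count_manyZeros_le D hDpos ht
    _ ≤ Real.exp (-(2 * t ^ 2 / (n - #A : ℕ))) * 2 ^ Fintype.card (⊤ : SimpleGraph (Fin n)).edgeSet := by
        refine mul_le_mul_of_nonneg_right (Real.exp_le_exp.2 (neg_le_neg ?_)) (by positivity)
        exact div_le_div_of_nonneg_left (by positivity) (by exact_mod_cast hDpos)
          (by exact_mod_cast hDcard)

end Summit.PneNP.PneNP.Theorems.MonotoneBlind.Negative
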